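import Literature.NumberTheory.Automorphic.Liu2021.Def411WeilCarriersAtLineClassTransportPU
import Literature.NumberTheory.Automorphic.Liu2021.Def411WeilCarriersAtLineReindex
import Summits.HodgeConjecture.CorCM.B01.Transposition.Item6OmegaChiSplitting
import HarnessLib

/-!
# Crux `H413` — stub S4a `StubT3aLineTransportAt` (T3a-LT, the finite-adélic LINE TRANSPORT) AT EVERY FRAME `e`

HC_CM is proved only modulo the printed citations until rung 0 closes.

A-p17 (g13) for the S4a lead F0P4-p06 (g0) (F0P4-plan (g3) 23:40:11Z (2) ∕ 23:41:11Z; line `Cruxes/H413/Lines/F0_P4AdmissibleOccursInH1.lean`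
ED. 2, letter `StubT3aLineTransportAt` ll. 411–438).  PROOF FILE (two theorems, no `def`, no `sorry`) for crux item `stmt-HodgeConjecture-24833`.

WHAT IS PROVED.
* `exists_omegaAtLine_equiv_rhoVAtLine_of_locF_eq_frame` — the unconditional master ★
  `Def411WeilCarriers.exists_omegaAtLine_equiv_rhoVAtLine_of_locF_eq` (F0P4-p06 (g0), frame `Equiv.prodUnique (Fin N) (Fin 1)`) MOVED TO AN
  ARBITRARY ENUMERATION `e : Fin N × Fin 1 ≃ Fin n` (general rank `N ≥ 1`): `Ψ := R_{e→e₁}(a₁) ≫ Ψ_{e₁} ≫ R_{e→e₁}(a₂)⁻¹` with the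
  enumeration-independence transports ★ `exists_omegaAtLine_equiv_rhoVAtLine_reindex` (F0P4-p04 (g0)); equivariance for `rhoVAtLine` on the nose.
* `lineTransportAt` — the BODY of the registered stub `StubT3aLineTransportAt` VERBATIM (frame binder `{n} (e : Fin 3 × Fin 1 ≃ Fin n)` general), so
  that the registrar's fold `theorem stub_T3a_lineTransportAt : StubT3aLineTransportAt := LineTransport.lineTransportAt` elaborates by unfolding;
  it IS the frame-general master at `N := 3`, the family `OmegaChiSplitting.hsChiD L e …` being
  `fun a ↦ isCompatible_chiSplittingLine L e … (TW a) (isSymm_TW a) (isUnit_det_TW a) (JW a) (JW_eq a)` by `δ` (`sChiD`), as in ★ `lineTransportAt_e₁`.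

Sources: [Liu2021, Def. 4.11 (l. 2092–2096), Def. 4.12, App. D §D.1 Step 1 footnote (l. 5217), Steps 2–3]; [GelbartRogawski1991, §3.1 Prop. 3.1.1
p. 455, Remark p. 457]; [MoeglinVignerasWaldspurger1987, Chap. 3 I.1–I.3]; [Flath1979, §2 Example 2].
-/

set_option autoImplicit false

-- the mandated namespace has the single-problem summit's repeated segment (`HodgeConjecture.HodgeConjecture`), as in every `Cruxes/…` module of this sub-problem
set_option linter.dupNamespace false

noncomputable section

namespace Summit.HodgeConjecture.HodgeConjecture.Cruxes.H413.LineTransport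

open NumberField
open scoped Matrix
open Literature.NumberTheory.Automorphic Literature.NumberTheory.Automorphic.UnitaryGroup
open Literature.NumberTheory.Automorphic.Liu2021
open Literature.NumberTheory.Automorphic.Liu2021.Def411WeilCarriers
open Literature.NumberTheory.Automorphic.Liu2021.Def411WeilCarriersDoubling
open Literature.NumberTheory.GelbartRogawski1991 Literature.NumberTheory.GelbartRogawski1991.UnitaryDualPair
open Literature.NumberTheory.GelbartRogawski1991.GRConstruction
open Literature.RepresentationTheory.HarrisKudlaSweet1996
open Literature.NumberTheory.GaloisRepresentations (HeckeCharacter)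
open Summit.HodgeConjecture.CorCM Summit.HodgeConjecture.CorCM.Transposition

section Frame

variable (L : Type) [Field L] [NumberField L] [IsCMField L] {N n : ℕ} (hN : 0 < N) (e : Fin N × Fin 1 ≃ Fin n)
  (dV : Fin N → L) (hdV : ∀ i, IsCMField.complexConj L (dV i) = dV i) (hdV0 : ∀ i, dV i ≠ 0)
  (θ : HeckeCharacter L) (hθu : θ.IsUnitary) (hθs : IsSplittingChar L 1 θ)
  (a₁ a₂ : (Fp L)ˣ) (χ : Chi (Fp L) L (IsCMField.complexConj L))

-- heartbeats: as for the master (the statement spells the two CM local families through `omegaAtLine`∕`rhoVAtLine`).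
set_option synthInstance.maxHeartbeats 400000 in
set_option maxHeartbeats 3200000 in
include hN in
/-- **THE LINE-CLASS TRANSPORT AT AN ARBITRARY ENUMERATION `e`** ([Liu2021, Def. 4.11 ∕ App. D §D.1 Step 1 footnote]): for a CM field `L`, a real
frame `dV` of rank `N ≥ 1`, ANY enumeration `e : Fin N × Fin 1 ≃ Fin n`, a unitary splitting character `θ`, `χ ∈ Chi` and lines `a₁, a₂ ∈ (L⁺)ˣ`
with `locF L⁺ δ² a₁ = locF L⁺ δ² a₂`, the carriers at the `θ`-attached splittings of `⟨a₁⟩` and `⟨a₂⟩` built at `e` are isomorphic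
`U(diag dV)(𝔸_{L⁺,f})`-equivariantly on the nose — the master ★ `exists_omegaAtLine_equiv_rhoVAtLine_of_locF_eq` at `Equiv.prodUnique` conjugated by
the enumeration-independence transports ★ `exists_omegaAtLine_equiv_rhoVAtLine_reindex` at `a₁` and at `a₂`.
[cite: Liu2021, Def. 4.11 (l. 2092–2096); App. D §D.1 Step 1 footnote (l. 5217), Steps 2–3 (l. 5217–5221)]
[cite: GelbartRogawski1991, §3.1 Remark p. 457 L4–13] [cite: Flath1979, §2 Example 2] -/
theorem exists_omegaAtLine_equiv_rhoVAtLine_of_locF_eq_frame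
    (hloc : locF (Fp L) (imagUnitSq L) a₁ = locF (Fp L) (imagUnitSq L) a₂) :
    ∃ Ψ : omegaAtLine (Fp L) L (IsCMField.complexConj L) N e (Matrix.diagonal dV)
          (complexConj_imagUnit L) (imagUnit_ne_zero L) (imagUnit_mul_self L) (realDiagonal_isSymm L dV hdV)
          (isUnit_det_realDiagonal L dV hdV hdV0) (realDiagonal_map L dV hdV).symm
          (fun b => isCompatible_chiSplittingLine L e dV hdV hdV0 θ hθu hθs (TW (Fp L) b)
            (isSymm_TW (Fp L) b) (isUnit_det_TW (Fp L) b) (JW (Fp L) L b) (JW_eq (Fp L) L b)) a₁ χ ≃ₗ[ℂ]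
        omegaAtLine (Fp L) L (IsCMField.complexConj L) N e (Matrix.diagonal dV)
          (complexConj_imagUnit L) (imagUnit_ne_zero L) (imagUnit_mul_self L) (realDiagonal_isSymm L dV hdV)
          (isUnit_det_realDiagonal L dV hdV hdV0) (realDiagonal_map L dV hdV).symm
          (fun b => isCompatible_chiSplittingLine L e dV hdV hdV0 θ hθu hθs (TW (Fp L) b)
            (isSymm_TW (Fp L) b) (isUnit_det_TW (Fp L) b) (JW (Fp L) L b) (JW_eq (Fp L) L b)) a₂ χ,
      ∀ (k : finAdelic (Fp L) L (IsCMField.complexConj L) N (Matrix.diagonal dV))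
        (y : omegaAtLine (Fp L) L (IsCMField.complexConj L) N e (Matrix.diagonal dV)
          (complexConj_imagUnit L) (imagUnit_ne_zero L) (imagUnit_mul_self L) (realDiagonal_isSymm L dV hdV)
          (isUnit_det_realDiagonal L dV hdV hdV0) (realDiagonal_map L dV hdV).symm
          (fun b => isCompatible_chiSplittingLine L e dV hdV hdV0 θ hθu hθs (TW (Fp L) b)
            (isSymm_TW (Fp L) b) (isUnit_det_TW (Fp L) b) (JW (Fp L) L b) (JW_eq (Fp L) L b)) a₁ χ),
        Ψ (rhoVAtLine (Fp L) L (IsCMField.complexConj L) N e (Matrix.diagonal dV)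
            (complexConj_imagUnit L) (imagUnit_ne_zero L) (imagUnit_mul_self L) (realDiagonal_isSymm L dV hdV)
            (isUnit_det_realDiagonal L dV hdV hdV0) (realDiagonal_map L dV hdV).symm
            (fun b => isCompatible_chiSplittingLine L e dV hdV hdV0 θ hθu hθs (TW (Fp L) b)
              (isSymm_TW (Fp L) b) (isUnit_det_TW (Fp L) b) (JW (Fp L) L b) (JW_eq (Fp L) L b)) a₁ χ k y) =
          rhoVAtLine (Fp L) L (IsCMField.complexConj L) N e (Matrix.diagonal dV)
            (complexConj_imagUnit L) (imagUnit_ne_zero L) (imagUnit_mul_self L) (realDiagonal_isSymm L dV hdV)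
            (isUnit_det_realDiagonal L dV hdV hdV0) (realDiagonal_map L dV hdV).symm
            (fun b => isCompatible_chiSplittingLine L e dV hdV hdV0 θ hθu hθs (TW (Fp L) b)
              (isSymm_TW (Fp L) b) (isUnit_det_TW (Fp L) b) (JW (Fp L) L b) (JW_eq (Fp L) L b)) a₂ χ k (Ψ y) := by
  obtain ⟨Ψ₁, hΨ₁⟩ := exists_omegaAtLine_equiv_rhoVAtLine_of_locF_eq L hN dV hdV hdV0 θ hθu hθs χ a₁ a₂ hloc
  obtain ⟨R, -, hR⟩ :=
    exists_omegaAtLine_equiv_rhoVAtLine_reindex L e (Equiv.prodUnique (Fin N) (Fin 1)) dV hdV hdV0 θ hθu hθs a₁ χ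
  obtain ⟨R', -, hR'⟩ :=
    exists_omegaAtLine_equiv_rhoVAtLine_reindex L e (Equiv.prodUnique (Fin N) (Fin 1)) dV hdV hdV0 θ hθu hθs a₂ χ
  refine ⟨(R ≪≫ₗ Ψ₁) ≪≫ₗ R'.symm, fun k y => ?_⟩
  simp only [LinearEquiv.trans_apply]
  rw [LinearEquiv.symm_apply_eq, hR', LinearEquiv.apply_symm_apply, hR, hΨ₁]

end Frame

set_option synthInstance.maxHeartbeats 400000 in
set_option maxHeartbeats 3200000 in
/-- **S4a AT EVERY FRAME** (= the body of the registered stub `StubT3aLineTransportAt`, ED. 2 ll. 411–438, verbatim): for `L` CM, ANY enumeration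
`e : Fin 3 × Fin 1 ≃ Fin n`, a real non-zero diagonal frame `dV`, a unitary splitting character `θ`, `a, a′ ∈ (L⁺)ˣ` with
`locF L⁺ δ² a = locF L⁺ δ² a′` and `χ ∈ Chi`, there is `Ψ : omegaAtLine … e … (hsChiD L e …) a χ ≃ₗ[ℂ] omegaAtLine … e … (hsChiD L e …) a′ χ`
intertwining `rhoVAtLine … a χ` and `rhoVAtLine … a′ χ` on the nose — `exists_omegaAtLine_equiv_rhoVAtLine_of_locF_eq_frame` at `N := 3`
(the family `hsChiD L e …` is the `isCompatible_chiSplittingLine` family by `δ`).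
[cite: Liu2021, Def. 4.11 (l. 2092–2096); App. D §D.1 Step 1 footnote (l. 5217), Steps 2–3 (l. 5217–5221)]
[cite: GelbartRogawski1991, §3.1 Prop. 3.1.1 p. 455 L1–3; Remark p. 457 L4–13] [cite: MoeglinVignerasWaldspurger1987, Chap. 3 I.1–I.3]
[cite: Flath1979, §2 Example 2] -/
theorem lineTransportAt :
    ∀ (L : Summit.HodgeConjecture.CorCM.CMField) {n : ℕ} (e : Fin 3 × Fin 1 ≃ Fin n) (dV : Fin 3 → L)
        (hdV : ∀ j, IsCMField.complexConj L (dV j) = dV j) (hdV0 : ∀ j, dV j ≠ 0)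
        (θ : Literature.NumberTheory.GaloisRepresentations.HeckeCharacter L) (hθu : θ.IsUnitary)
        (hθs : Literature.RepresentationTheory.HarrisKudlaSweet1996.IsSplittingChar L 1 θ)
        (a a' : (↥(maximalRealSubfield L))ˣ) (χ : Def411WeilCarriers.Chi ↥(maximalRealSubfield L) L (IsCMField.complexConj L)),
        locF ↥(maximalRealSubfield L) (imagUnitSq L) a = locF ↥(maximalRealSubfield L) (imagUnitSq L) a' →
          ∃ Ψ : Def411WeilCarriers.omegaAtLine ↥(maximalRealSubfield L) L (IsCMField.complexConj L) 3 e (Matrix.diagonal dV)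
                (complexConj_imagUnit L) (imagUnit_ne_zero L) (imagUnit_mul_self L) (realDiagonal_isSymm L dV hdV)
                (isUnit_det_realDiagonal L dV hdV hdV0) (realDiagonal_map L dV hdV).symm (OmegaChiSplitting.hsChiD L e dV hdV hdV0 θ hθu hθs)
                a χ ≃ₗ[ℂ]
              Def411WeilCarriers.omegaAtLine ↥(maximalRealSubfield L) L (IsCMField.complexConj L) 3 e (Matrix.diagonal dV)
                (complexConj_imagUnit L) (imagUnit_ne_zero L) (imagUnit_mul_self L) (realDiagonal_isSymm L dV hdV)
                (isUnit_det_realDiagonal L dV hdV hdV0) (realDiagonal_map L dV hdV).symm (OmegaChiSplitting.hsChiD L e dV hdV hdV0 θ hθu hθs)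
                a' χ,
            ∀ (k : ↥(UnitaryGroup.finAdelic ↥(maximalRealSubfield L) L (IsCMField.complexConj L) 3 (Matrix.diagonal dV)))
              (x : Def411WeilCarriers.omegaAtLine ↥(maximalRealSubfield L) L (IsCMField.complexConj L) 3 e (Matrix.diagonal dV)
                (complexConj_imagUnit L) (imagUnit_ne_zero L) (imagUnit_mul_self L) (realDiagonal_isSymm L dV hdV)
                (isUnit_det_realDiagonal L dV hdV hdV0) (realDiagonal_map L dV hdV).symm (OmegaChiSplitting.hsChiD L e dV hdV hdV0 θ hθu hθs)
                a χ),
              Ψ (Def411WeilCarriers.rhoVAtLine ↥(maximalRealSubfield L) L (IsCMField.complexConj L) 3 e (Matrix.diagonal dV)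
                  (complexConj_imagUnit L) (imagUnit_ne_zero L) (imagUnit_mul_self L) (realDiagonal_isSymm L dV hdV)
                  (isUnit_det_realDiagonal L dV hdV hdV0) (realDiagonal_map L dV hdV).symm (OmegaChiSplitting.hsChiD L e dV hdV hdV0 θ hθu hθs)
                  a χ k x) =
                Def411WeilCarriers.rhoVAtLine ↥(maximalRealSubfield L) L (IsCMField.complexConj L) 3 e (Matrix.diagonal dV)
                  (complexConj_imagUnit L) (imagUnit_ne_zero L) (imagUnit_mul_self L) (realDiagonal_isSymm L dV hdV)
                  (isUnit_det_realDiagonal L dV hdV hdV0) (realDiagonal_map L dV hdV).symm (OmegaChiSplitting.hsChiD L e dV hdV hdV0 θ hθu hθs)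
                  a' χ k (Ψ x) :=
  fun L _ e dV hdV hdV0 θ hθu hθs a a' χ h =>
    exists_omegaAtLine_equiv_rhoVAtLine_of_locF_eq_frame L (by norm_num) e dV hdV hdV0 θ hθu hθs a a' χ h

end Summit.HodgeConjecture.HodgeConjecture.Cruxes.H413.LineTransport

end
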